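import Summits.BirchSwinnertonDyer.BirchSwinnertonDyer.Theorems.ManinLocalTwoThreeBlindFamilyTamagawa
import Literature.NumberTheory.EllipticCurves.SzpiroLocalDataProofs
import HarnessLib
import HarnessLib.Audit.Tags

/-!
# The blind family's local types and CONDUCTOR: `E′_m` is IV* at `2` with `N = 4p` (`m ≡ 1 (4)`), I₀* at `2` with
# `N = 16p` (`m ≡ 3 (4)`), I₂ at `p = m² + 4` — SYMBOLICALLY in `m`
# (cell `bsd-f2-manin`, crux C2 `ManinOddAtFour` stmt-BirchSwinnertonDyer-22967; C2/C3 LEAD p1 gen 8; support)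

Summit `BirchSwinnertonDyer`, route `ManinLocalTwoThree`.  The cell's rows on the blind family
`E′_m = ShimuraLedger.blindCurve m = [0, −2m, 0, m² + 4, 0]` are typed at the LEVEL `4p` (`OddDegreeTooth.FourPBlindFamily*`,
`TwoEisensteinRankOneLaws.FourPFamily*`) resp. `(if m % 4 = 1 then 4 else 16)·(m² + 4)` (`FourPFamilyManinLaws`), and the C2 crux
`ManinOddAtFour` is the statement at levels `4 ∣ N`.  This file makes the level choice a TREE THEOREM: for odd `m` with
`p = m² + 4` prime the CONDUCTOR of `E′_m` is `4p` if `m ≡ 1 (mod 4)` and `16p` if `m ≡ 3 (mod 4)` — so the family lies in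
the crux's regime `2² ∣ N(E′_m)`, in the TAME cell `4 ∥ N` exactly when `m ≡ 1 (mod 4)`.

Proof (Tate's algorithm read SYMBOLICALLY through the rank-2 observatory's integer-equation layer, as in
`…BlindFamilyTamagawa`; the tree's conductor exponent IS Ogg's formula `f = ord Δ_min + 1 − m`):
* at `2`, on the translate `M = (1, m, 1, 2) • E′_m = [2, m − 1, 4, 0, 4(m − 1)]` with `2⁸ ∥ Δ`:
  `m ≡ 1 (4)` ⟹ Step 8 normal form, `(a₃/4)² + 4(a₆/16)` odd ⟹ **IV*** (`kodairaSymbolOfMinimal_intCast_eq_IVstar`),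
  `f₂ = 8 + 1 − 7 = 2`; `m ≡ 3 (4)` ⟹ Step 6 normal form with separable cubic (odd `disc3`) ⟹ **I₀***
  (`kodairaSymbolOfMinimal_intCast_eq_Istar_zero`), `f₂ = 8 + 1 − 5 = 4` (`kodairaSymbolAt_blind_two_*`,
  `conductorExponent_blind_two`);
* at `p`: `p ∣ Δ`, `p ∤ c₄` ⟹ multiplicative, `f_p = 1`; elsewhere good, `f = 0` (`conductorExponent_blind_odd`);
* `N = ∏ q^{f_q}` (`factorization_conductorNorm_primesEquiv_symm`) ⟹ `conductorNorm_blindCurve`.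

What this is NOT: nothing about modular parametrisations or the Manin constant of `E′_m`; `--supports 22967`.
BSD is not proved by this; Manin's conjecture is not proved by this.

References: [Tate1975] §7–8; [Silverman1994] IV.9.4 Steps 2, 6, 8, Table 4.1, IV.10.2, IV.11.1 (Ogg's formula);
[SilvermanAEC2009] VII.1 Rem. 1.1, VII.5 Prop. 5.1, C.16; [Ogg1967].
-/

set_option autoImplicit false
-- lint-debt: the directory name repeats the summit name (sibling precedent `ManinLocalTwoThreeBlindFamilyTamagawa.lean`)
set_option linter.dupNamespace false

noncomputable section

open scoped Classical NumberField

open IsLocalRing IsDedekindDomain Rat.HeightOneSpectrum WeierstrassCurve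
  Literature.NumberTheory.EllipticCurves Literature.NumberTheory.GaloisRepresentations
  Literature.NumberTheory.DiophantineGeometry Literature.NumberTheory.DiophantineGeometry.TateAlgorithm
  Summit.BirchSwinnertonDyer.BirchSwinnertonDyer.Rank2Observatory
  Summit.BirchSwinnertonDyer.BirchSwinnertonDyer.Rank2Observatory.Tam
  Summit.BirchSwinnertonDyer.BirchSwinnertonDyer.Rank2Observatory.Tate
  Summit.BirchSwinnertonDyer.Rank1Residual.ManinAdditive
  Summit.BirchSwinnertonDyer.Rank1Residual.ManinAdditive.ShimuraLedger

namespace Summit.BirchSwinnertonDyer.BirchSwinnertonDyer.Theorems.ManinLocalTwoThree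

/-! ### §1 Kodaira symbols at `2` -/

/-- **`E′_m` is of type IV* at `2` with `ord₂ Δ_min = 8`, for `m ≡ 1 (mod 4)`** (on the translate
`[2, m − 1, 4, 0, 4(m − 1)]`: `2 ∣ a₁`, `4 ∣ a₂, a₃`, `8 ∣ a₄`, `16 ∣ a₆`, `(a₃/4)² + 4(a₆/16) = 1 + (m − 1)/4·4` odd).
[cite: Tate1975, §8] [cite: Silverman1994, IV.9.4 Step 8] -/
theorem kodairaSymbolAt_blind_two_of_emod_four_eq_one {m : ℤ} (hm4 : m % 4 = 1)
    (v : HeightOneSpectrum (𝓞 ℚ)) (hv : natGenerator v = 2)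
    (hmin : ((⟨0, -2 * m, 0, m ^ 2 + 4, 0⟩ : WeierstrassCurve ℤ).baseChange ℚ).IsMinimalAt v) :
    ((⟨0, -2 * m, 0, m ^ 2 + 4, 0⟩ : WeierstrassCurve ℤ).baseChange ℚ).kodairaSymbolAt v = .IVstar ∧
      ((⟨0, -2 * m, 0, m ^ 2 + 4, 0⟩ : WeierstrassCurve ℤ).baseChange ℚ).ordMinimalDiscriminant v = 8 := by
  obtain ⟨k, hk⟩ : ∃ k, m = 4 * k + 1 := ⟨m / 4, by omega⟩
  have hodd : Odd m := ⟨2 * k, by omega⟩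
  obtain ⟨h8, h9⟩ := two_pow_eight_exact hodd
  haveI := perfectField_residueField_adicCompletionIntegers (K := ℚ) v
  refine kodairaSymbolAt_and_ordMinimalDiscriminant_of_intModel (v := v) hv _
    (⟨2, m - 1, 4, 0, 4 * (m - 1)⟩ : WeierstrassCurve ℤ) ⟨1, m, 1, 2⟩ rfl (blindInt_translate m)
    (isMinimalAt_translate v ⟨1, m, 1, 2⟩ rfl (blindInt_translate m) hmin)
    (n := 8) (by rw [blindTranslate_Δ]; exact_mod_cast h8) (by rw [blindTranslate_Δ]; exact_mod_cast h9)
    fun ε hε hpε => ?_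
  refine kodairaSymbolOfMinimal_intCast_eq_IVstar Nat.prime_two hε hpε ?_ ?_ ?_ ?_ ?_ ?_
  · norm_num
  · subst hk; norm_num
  · norm_num
  · norm_num
  · subst hk; norm_num; omega
  · subst hk; norm_num; omega

/-- **`E′_m` is of type I₀* at `2` with `ord₂ Δ_min = 8`, for `m ≡ 3 (mod 4)`** (on the translate: Step-6 normal form
`2 ∣ a₁, a₂`, `4 ∣ a₃, a₄`, `8 ∣ a₆`, cubic `T³ + (2k+1)T² + (2k+1)` with odd discriminant). [cite: Tate1975, §7]
[cite: Silverman1994, IV.9.4 Step 6] -/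
theorem kodairaSymbolAt_blind_two_of_emod_four_eq_three {m : ℤ} (hm4 : m % 4 = 3)
    (v : HeightOneSpectrum (𝓞 ℚ)) (hv : natGenerator v = 2)
    (hmin : ((⟨0, -2 * m, 0, m ^ 2 + 4, 0⟩ : WeierstrassCurve ℤ).baseChange ℚ).IsMinimalAt v) :
    ((⟨0, -2 * m, 0, m ^ 2 + 4, 0⟩ : WeierstrassCurve ℤ).baseChange ℚ).kodairaSymbolAt v = .Istar 0 ∧
      ((⟨0, -2 * m, 0, m ^ 2 + 4, 0⟩ : WeierstrassCurve ℤ).baseChange ℚ).ordMinimalDiscriminant v = 8 := by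
  obtain ⟨k, hk⟩ : ∃ k, m = 4 * k + 3 := ⟨m / 4, by omega⟩
  have hodd : Odd m := ⟨2 * k + 1, by omega⟩
  obtain ⟨h8, h9⟩ := two_pow_eight_exact hodd
  haveI := perfectField_residueField_adicCompletionIntegers (K := ℚ) v
  refine kodairaSymbolAt_and_ordMinimalDiscriminant_of_intModel (v := v) hv _
    (⟨2, m - 1, 4, 0, 4 * (m - 1)⟩ : WeierstrassCurve ℤ) ⟨1, m, 1, 2⟩ rfl (blindInt_translate m)
    (isMinimalAt_translate v ⟨1, m, 1, 2⟩ rfl (blindInt_translate m) hmin)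
    (n := 8) (by rw [blindTranslate_Δ]; exact_mod_cast h8) (by rw [blindTranslate_Δ]; exact_mod_cast h9)
    fun ε hε hpε => ?_
  set M : WeierstrassCurve ℤ := ⟨2, m - 1, 4, 0, 4 * (m - 1)⟩ with hM
  have hA2 : M.a₂ / ((2 : ℕ) : ℤ) ^ 1 = 2 * k + 1 := by rw [hM, hk]; norm_num; omega
  have hB4 : M.a₄ / ((2 : ℕ) : ℤ) ^ 2 = 0 := by rw [hM]; norm_num
  have hB6 : M.a₆ / ((2 : ℕ) : ℤ) ^ 3 = 2 * k + 1 := by rw [hM, hk]; norm_num; omega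
  refine kodairaSymbolOfMinimal_intCast_eq_Istar_zero (M := M) Nat.prime_two hε hpε
    (by rw [hM]; norm_num) (by rw [hM, hk]; norm_num; exact ⟨2 * k + 1, by ring⟩) (by rw [hM]; norm_num)
    (by rw [hM]; norm_num) (by rw [hM, hk]; norm_num; exact ⟨2 * k + 1, by ring⟩) ?_
  rw [hA2, hB4, hB6, disc3, pow_one]
  rw [show (2 * k + 1) ^ 2 * (0 : ℤ) ^ 2 - 4 * 0 ^ 3 - 4 * (2 * k + 1) ^ 3 * (2 * k + 1) -
      27 * (2 * k + 1) ^ 2 + 18 * (2 * k + 1) * 0 * (2 * k + 1) =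
      2 * (-(2 * (2 * k + 1) ^ 4 + 54 * k ^ 2 + 54 * k + 14)) + 1 by ring]
  omega

/-! ### §2 Conductor exponents -/

/-- **`f₂(E′_m) = 2` (`m ≡ 1 (4)`, IV*: `8 + 1 − 7`) resp. `4` (`m ≡ 3 (4)`, I₀*: `8 + 1 − 5`)** — the tree's conductor exponent is
Ogg's formula. [cite: Silverman1994, IV.11.1] [cite: Ogg1967] -/
theorem conductorExponent_blind_two {m : ℤ} (hm : Odd m)
    (hGM : ((⟨0, -2 * m, 0, m ^ 2 + 4, 0⟩ : WeierstrassCurve ℤ).baseChange ℚ).IsGloballyMinimal)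
    [((⟨0, -2 * m, 0, m ^ 2 + 4, 0⟩ : WeierstrassCurve ℤ).baseChange ℚ).IsElliptic]
    (v : HeightOneSpectrum ℤ) (hv : natGenerator v = 2) :
    ((⟨0, -2 * m, 0, m ^ 2 + 4, 0⟩ : WeierstrassCurve ℤ).baseChange ℚ).conductorExponent v =
      if m % 4 = 1 then 2 else 4 := by
  obtain ⟨v', hvv', hgen⟩ := DeepCert.exists_place_of_int v
  rw [conductorExponent_eq_of_primesEquiv_eq v v' _ hvv']
  have hmin := hGM.isMinimal v'
  unfold WeierstrassCurve.conductorExponent WeierstrassCurve.numComponentsAt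
  by_cases h1 : m % 4 = 1
  · obtain ⟨hK, hn⟩ := kodairaSymbolAt_blind_two_of_emod_four_eq_one h1 v' (hgen.trans hv) hmin
    rw [hK, hn, if_pos h1]
    rfl
  · have h3 : m % 4 = 3 := by obtain ⟨j, hj⟩ := hm; omega
    obtain ⟨hK, hn⟩ := kodairaSymbolAt_blind_two_of_emod_four_eq_three h3 v' (hgen.trans hv) hmin
    rw [hK, hn, if_neg h1]
    rfl

/-- A prime dividing `Δ(E′_m) = −2⁸ p²` is `2` or `p`. [folklore] -/
theorem eq_two_or_eq_of_prime_dvd_blindInt_Δ {m : ℤ} (hp : Nat.Prime (m ^ 2 + 4).natAbs) {q : ℕ}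
    (hq : q.Prime) (hd : (q : ℤ) ∣ (⟨0, -2 * m, 0, m ^ 2 + 4, 0⟩ : WeierstrassCurve ℤ).Δ) :
    q = 2 ∨ q = (m ^ 2 + 4).natAbs := by
  have hpos : 0 < m ^ 2 + 4 := by positivity
  have hpz : (((m ^ 2 + 4).natAbs : ℕ) : ℤ) = m ^ 2 + 4 := Int.natAbs_of_nonneg hpos.le
  rw [blindInt_Δ, ← hpz] at hd
  have hd' : q ∣ 256 * (m ^ 2 + 4).natAbs ^ 2 := by
    have := Int.natAbs_dvd_natAbs.mpr hd
    simpa [Int.natAbs_mul, Int.natAbs_pow] using this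
  rcases (Nat.Prime.dvd_mul hq).mp hd' with h | h
  · exact Or.inl ((Nat.prime_dvd_prime_iff_eq hq Nat.prime_two).mp
      (hq.dvd_of_dvd_pow (n := 8) (by norm_num; exact h)))
  · exact Or.inr ((Nat.prime_dvd_prime_iff_eq hq hp).mp (hq.dvd_of_dvd_pow h))

/-- **`f_q(E′_m)` at the odd places**: `1` at `p = m² + 4` (multiplicative: `p ∣ Δ`, `p ∤ c₄`), `0` elsewhere (good).
[cite: Silverman1994, IV.10.2] [cite: SilvermanAEC2009, VII.5 Prop. 5.1] -/
theorem conductorExponent_blind_odd {m : ℤ} (hm : Odd m) (hp : Nat.Prime (m ^ 2 + 4).natAbs)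
    [((⟨0, -2 * m, 0, m ^ 2 + 4, 0⟩ : WeierstrassCurve ℤ).baseChange ℚ).IsElliptic]
    (v : HeightOneSpectrum ℤ) (hv : natGenerator v ≠ 2) :
    ((⟨0, -2 * m, 0, m ^ 2 + 4, 0⟩ : WeierstrassCurve ℤ).baseChange ℚ).conductorExponent v =
      if natGenerator v = (m ^ 2 + 4).natAbs then 1 else 0 := by
  set p : ℕ := (m ^ 2 + 4).natAbs with hpdef
  set W₀ : WeierstrassCurve ℤ := ⟨0, -2 * m, 0, m ^ 2 + 4, 0⟩ with hW₀
  have hq := prime_natGenerator v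
  have hpos : 0 < m ^ 2 + 4 := by positivity
  have hpz : (p : ℤ) = m ^ 2 + 4 := Int.natAbs_of_nonneg hpos.le
  by_cases hvp : natGenerator v = p
  · rw [if_pos hvp]
    have h256 : ¬ (p : ℤ) ∣ 256 := natAbs_sq_add_four_not_dvd_256 hm hp
    have hΔ : (natGenerator v : ℤ) ∣ W₀.Δ := by
      rw [hvp, hW₀, blindInt_Δ, ← hpz]
      exact ⟨-256 * (p : ℤ), by ring⟩
    have hc4 : ¬ (natGenerator v : ℤ) ∣ W₀.c₄ := by
      rw [hvp, hW₀, blindInt_c₄]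
      intro h
      have h16 : (p : ℤ) ∣ 16 * (m ^ 2 + 4) := by rw [← hpz]; exact Dvd.intro_left _ rfl
      have := dvd_sub h16 h
      rw [show (16 : ℤ) * (m ^ 2 + 4) - 16 * (m ^ 2 - 12) = 256 by ring] at this
      exact h256 this
    exact (conductorExponent_eq_one_iff_holds v _).mpr
      (RootNumber.hasMultiplicativeReductionAt_of_dvd_of_not_dvd hΔ hc4)
  · rw [if_neg hvp]
    refine (conductorExponent_eq_zero_iff_holds v _).mpr (RootNumber.hasGoodReductionAt_of_not_dvd fun hd => ?_)
    rcases eq_two_or_eq_of_prime_dvd_blindInt_Δ hp hq hd with h | h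
    · exact hv h
    · exact hvp h

/-! ### §3 The conductor -/

/-- **`N(E′_m) = 2^{f₂} · p` on the integer equation** (odd `m`, `p = m² + 4` prime, the equation globally minimal):
`N = ∏ q^{f_q}` with `f₂ ∈ {2, 4}` by `m mod 4`, `f_p = 1`, `f_q = 0` otherwise. [cite: SilvermanAEC2009, C.16] [cite: Silverman1994, IV.11.1] -/
theorem conductorNorm_blindInt {m : ℤ} (hm : Odd m) (hp : Nat.Prime (m ^ 2 + 4).natAbs)
    (hGM : ((⟨0, -2 * m, 0, m ^ 2 + 4, 0⟩ : WeierstrassCurve ℤ).baseChange ℚ).IsGloballyMinimal) :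
    ((⟨0, -2 * m, 0, m ^ 2 + 4, 0⟩ : WeierstrassCurve ℤ).baseChange ℚ).conductorNorm ℤ =
      2 ^ (if m % 4 = 1 then 2 else 4) * (m ^ 2 + 4).natAbs := by
  set p : ℕ := (m ^ 2 + 4).natAbs with hpdef
  set W₀ : WeierstrassCurve ℤ := ⟨0, -2 * m, 0, m ^ 2 + 4, 0⟩ with hW₀
  have hpos : 0 < m ^ 2 + 4 := by positivity
  have hpz : (p : ℤ) = m ^ 2 + 4 := Int.natAbs_of_nonneg hpos.le
  have hp2 : p ≠ 2 := by
    intro h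
    obtain ⟨j, hj⟩ := odd_sq_add_four hm
    rw [h] at hpz
    push_cast at hpz
    omega
  have hΔ0 : W₀.Δ ≠ 0 := by
    rw [hW₀, blindInt_Δ]; exact mul_ne_zero (by norm_num) (pow_ne_zero _ hpos.ne')
  haveI hE : (W₀.baseChange ℚ).IsElliptic := WeierstrassCurve.isElliptic_baseChange_int _ hΔ0
  set e : ℕ := if m % 4 = 1 then 2 else 4 with he
  refine Nat.eq_of_factorization_eq ((W₀.baseChange ℚ).conductorNorm_pos_holds).ne'
    (mul_ne_zero (pow_ne_zero _ (by norm_num)) hp.ne_zero) fun q => ?_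
  by_cases hq : q.Prime
  swap
  · rw [Nat.factorization_eq_zero_of_not_prime _ hq, Nat.factorization_eq_zero_of_not_prime _ hq]
  rw [show q = ((⟨q, hq⟩ : Nat.Primes) : ℕ) from rfl, WeierstrassCurve.factorization_conductorNorm_primesEquiv_symm,
    Nat.factorization_mul (pow_ne_zero _ (by norm_num)) hp.ne_zero, Finsupp.add_apply,
    Nat.Prime.factorization_pow Nat.prime_two, hp.factorization]
  set v := (primesEquiv (R := ℤ)).symm ⟨q, hq⟩ with hv
  have hgen : natGenerator v = q := Literature.NumberTheory.EllipticCurves.Rat.natGenerator_primesEquiv_symm ⟨q, hq⟩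
  by_cases hq2 : q = 2
  · rw [conductorExponent_blind_two hm hGM v (hgen.trans hq2)]
    simp [hq2, hp2.symm, he]
  · rw [conductorExponent_blind_odd hm hp v (by rw [hgen]; exact hq2), hgen, ← hpdef]
    by_cases hqp : q = p
    · simp [hqp, hp2]
    · simp [hq2, hqp]

/-- **The conductor of the blind curve**: `N(E′_m) = 4p` for `m ≡ 1 (mod 4)` and `16p` for `m ≡ 3 (mod 4)`
(odd `m`, `p = m² + 4` prime) — the level at which the cell's family rows are typed. [cite: Silverman1994, IV.11.1 and Table 4.1] -/
theorem conductorNorm_blindCurve {m : ℤ} (hm : Odd m) (hp : Nat.Prime (m ^ 2 + 4).natAbs) :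
    haveI := OddDegreeTooth.isElliptic_blindCurve m
    (blindCurve m).conductorNorm ℤ = (if m % 4 = 1 then 4 else 16) * (m ^ 2 + 4).natAbs := by
  have hGM := isGloballyMinimal_blindCurve hm
  have hE := OddDegreeTooth.isElliptic_blindCurve m
  rw [blindCurve_eq_baseChange] at hGM hE ⊢
  rw [@conductorNorm_blindInt m hm hp hGM]
  split <;> norm_num

/-- **The blind family lies in the regime of the crux C2 `ManinOddAtFour`**: `2² ∣ N(E′_m)`. [folklore] -/
theorem four_dvd_conductorNorm_blindCurve {m : ℤ} (hm : Odd m) (hp : Nat.Prime (m ^ 2 + 4).natAbs) :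
    haveI := OddDegreeTooth.isElliptic_blindCurve m
    2 ^ 2 ∣ (blindCurve m).conductorNorm ℤ := by
  rw [conductorNorm_blindCurve hm hp]
  split
  · exact Dvd.dvd.mul_right (by norm_num) _
  · exact Dvd.dvd.mul_right (by norm_num) _

/-- **The TAME cell `4 ∥ N(E′_m)` is exactly `m ≡ 1 (mod 4)`.** [folklore] -/
theorem not_eight_dvd_conductorNorm_blindCurve_iff {m : ℤ} (hm : Odd m) (hp : Nat.Prime (m ^ 2 + 4).natAbs) :
    haveI := OddDegreeTooth.isElliptic_blindCurve m
    ¬ 2 ^ 3 ∣ (blindCurve m).conductorNorm ℤ ↔ m % 4 = 1 := by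
  have hodd : Odd (m ^ 2 + 4).natAbs := Int.natAbs_odd.mpr (odd_sq_add_four hm)
  rw [conductorNorm_blindCurve hm hp]
  constructor
  · intro h
    by_contra h1
    rw [if_neg h1] at h
    exact h (Dvd.dvd.mul_right (by norm_num) _)
  · intro h1 h8
    rw [if_pos h1] at h8
    obtain ⟨c, hc⟩ := h8
    have h2 : 2 ∣ (m ^ 2 + 4).natAbs := ⟨c, by norm_num at hc; omega⟩
    exact (Nat.not_even_iff_odd.mpr hodd) (even_iff_two_dvd.mpr h2)

end Summit.BirchSwinnertonDyer.BirchSwinnertonDyer.Theorems.ManinLocalTwoThree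

end
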